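import Mathlib
import HarnessLib
import Summits.Parity.BatemanHorn.Theorems.IsogenyRedeiSplitBlockJacobiWeylDefs
import Summits.Parity.BatemanHorn.Theorems.IsogenyRedeiSplitBlockJacobiPairForm

/-!
# Crux `SplitBlockJacobiCorner` (stmt-Parity-15002, route `IsogenyRedei`), line `Sketch`:
# the pair-side Fubini identity for the CORNER sum (`stub_cornerPairForm`)

For `1/2 < θ`, any `μ`, and `x ≥ 4`,
`Σ_{1 ≤ t ≤ x} Σ_{(Q,Q′) ∈ pf(t²+1)², x^θ < Q < Q′, QQ′ ≤ x^{2−μ}} (Q|Q′)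
  = Σ_{(Q,Q′) ∈ P_θ(x), QQ′ ≤ x^{2−μ}} (Q|Q′) · A_{QQ′}(x)`,
where `P_θ(x) = pairs θ x` is the landed FREE set of prime pairs `Q ≡ Q′ ≡ 1 (mod 4)`,
`x^θ < Q < Q′`, `QQ′ ≤ x²+1` (coordinates `< x²+2`), and `A_q(x) = rootCount q x` is the landed
small-root count `#{1 ≤ t ≤ x : q ∣ t²+1}`.

This is the landed `stub_pairForm` (file `IsogenyRedeiSplitBlockJacobiPairForm`) with the extra
product cut `QQ′ ≤ x^{2−μ}` carried on both sides.  Pure finite combinatorics: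

* `cornerPairForm_filter_eq`: for `1 ≤ t ≤ x` the inner filter of the corner sum at `t` equals
  `(P_θ(x).filter (QQ′ ≤ x^{2−μ})).filter (QQ′ ∣ t²+1)` — propositional bookkeeping on top of the
  landed key set identity `pairForm_filter_eq` (which needs `2 ≤ x^θ`, from
  `two_le_rpow_of_four_le`);
* `stub_cornerPairForm`: rewrite the inner sums, write `rootCount` as a sum of ones, and swap the
  two finite sums (`Finset.sum_comm'`), exactly as in the landed proof of `stub_pairForm`.
-/

noncomputable section

open Finset

namespace Summit.Parity.BatemanHorn.Cruxes.SplitBlockJacobiCorner.Sketch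

open Summit.Parity.BatemanHorn.Cruxes.SplitBlockJacobi.CofactorRootDiscrepancy

/-- **Corner set identity.** If `2 ≤ x^θ` and `1 ≤ t ≤ x`, the pairs `(Q, Q′)` of prime factors
of `t²+1` with `x^θ < Q < Q′` and `QQ′ ≤ x^{2−μ}` are exactly the pairs of the cut free pair set
`(pairs θ x).filter (QQ′ ≤ x^{2−μ})` with `QQ′ ∣ t²+1`.  From the landed `pairForm_filter_eq`
by membership bookkeeping. [folklore] -/
theorem cornerPairForm_filter_eq {θ μ : ℝ} {x t : ℕ} (hx2 : (2 : ℝ) ≤ (x : ℝ) ^ θ)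
    (ht : t ∈ Finset.Icc 1 x) :
    ((t ^ 2 + 1).primeFactors ×ˢ (t ^ 2 + 1).primeFactors).filter
        (fun q : ℕ × ℕ => (x : ℝ) ^ θ < (q.1 : ℝ) ∧ q.1 < q.2 ∧
          ((q.1 * q.2 : ℕ) : ℝ) ≤ (x : ℝ) ^ (2 - μ)) =
      ((pairs θ x).filter (fun q : ℕ × ℕ => ((q.1 * q.2 : ℕ) : ℝ) ≤ (x : ℝ) ^ (2 - μ))).filter
        (fun q : ℕ × ℕ => q.1 * q.2 ∣ t ^ 2 + 1) := by
  have key : ((t ^ 2 + 1).primeFactors ×ˢ (t ^ 2 + 1).primeFactors).filter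
        (fun q : ℕ × ℕ => (x : ℝ) ^ θ < (q.1 : ℝ) ∧ q.1 < q.2) =
      (pairs θ x).filter (fun q : ℕ × ℕ => q.1 * q.2 ∣ t ^ 2 + 1) :=
    pairForm_filter_eq hx2 ht
  ext q
  have hq := Finset.ext_iff.mp key q
  simp only [Finset.mem_filter] at hq ⊢
  tauto

/-- **`stub_cornerPairForm`** (pair-side Fubini with the product cut).  For `1/2 < θ`, any `μ`,
and `x ≥ 4`:
`Σ_{1 ≤ t ≤ x} Σ_{(Q,Q′) ∈ pf(t²+1)², x^θ < Q < Q′, QQ′ ≤ x^{2−μ}} (Q|Q′)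
  = Σ_{(Q,Q′) ∈ pairs θ x, QQ′ ≤ x^{2−μ}} (Q|Q′) · rootCount (QQ′) x`.
By `cornerPairForm_filter_eq` termwise in `t`, `rootCount` as a sum of ones, and
`Finset.sum_comm'`. [folklore] -/
theorem stub_cornerPairForm :
    ∀ θ μ : ℝ, 1 / 2 < θ → ∀ x : ℕ, 4 ≤ x →
      (∑ t ∈ Finset.Icc 1 x, ∑ q ∈ ((t ^ 2 + 1).primeFactors ×ˢ (t ^ 2 + 1).primeFactors).filter
          (fun q : ℕ × ℕ => (x : ℝ) ^ θ < (q.1 : ℝ) ∧ q.1 < q.2 ∧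
            ((q.1 * q.2 : ℕ) : ℝ) ≤ (x : ℝ) ^ (2 - μ)),
          (jacobiSym (q.1 : ℤ) q.2 : ℝ)) =
        ∑ q ∈ (pairs θ x).filter (fun q : ℕ × ℕ => ((q.1 * q.2 : ℕ) : ℝ) ≤ (x : ℝ) ^ (2 - μ)),
          (jacobiSym (q.1 : ℤ) q.2 : ℝ) * (rootCount (q.1 * q.2) x : ℝ) := by
  intro θ μ hθ x hx
  have hx2 : (2 : ℝ) ≤ (x : ℝ) ^ θ := two_le_rpow_of_four_le hθ hx
  set P : Finset (ℕ × ℕ) :=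
    (pairs θ x).filter (fun q : ℕ × ℕ => ((q.1 * q.2 : ℕ) : ℝ) ≤ (x : ℝ) ^ (2 - μ)) with hP
  have hL : ∀ t ∈ Finset.Icc 1 x,
      ∑ q ∈ ((t ^ 2 + 1).primeFactors ×ˢ (t ^ 2 + 1).primeFactors).filter
          (fun q : ℕ × ℕ => (x : ℝ) ^ θ < (q.1 : ℝ) ∧ q.1 < q.2 ∧
            ((q.1 * q.2 : ℕ) : ℝ) ≤ (x : ℝ) ^ (2 - μ)),
          (jacobiSym (q.1 : ℤ) q.2 : ℝ) =
        ∑ q ∈ P.filter (fun q : ℕ × ℕ => q.1 * q.2 ∣ t ^ 2 + 1),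
          (jacobiSym (q.1 : ℤ) q.2 : ℝ) := fun t ht => by
    rw [cornerPairForm_filter_eq hx2 ht]
  have hR : ∀ q ∈ P,
      (jacobiSym (q.1 : ℤ) q.2 : ℝ) * (rootCount (q.1 * q.2) x : ℝ) =
        ∑ _t ∈ (Finset.Icc 1 x).filter (fun t : ℕ => q.1 * q.2 ∣ t ^ 2 + 1),
          (jacobiSym (q.1 : ℤ) q.2 : ℝ) := fun q _ => by
    rw [rootCount, Finset.sum_const, nsmul_eq_mul, mul_comm]
  rw [Finset.sum_congr rfl hL, Finset.sum_congr rfl hR]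
  refine Finset.sum_comm' fun t q => ?_
  simp only [Finset.mem_filter]
  tauto

end Summit.Parity.BatemanHorn.Cruxes.SplitBlockJacobiCorner.Sketch

end
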